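import Mathlib
import Summits.KontsevichZagierPeriods.KontsevichZagierPeriods.Theorems.SoloInformedZetaFourStep
import HarnessLib
import HarnessLib.Audit

/-!
# SoloInformed — weight 4, the garland side: `R₁ ≡ G ≡ G_a + G_b + G_c`

Solo programme `solo-KontsevichZagierPeriods-informed`, session s45 (PART XVI). The left side of the
weight-4 telescope step, `R₁ = [(0,1)⁴ ∩ {x₃ < x₀}, 1/((1 − x₀x₁x₂)(1 − x₃))]`, is carried by the
polynomial substitution `λ(x) = (x₀, x₀x₁, x₀x₁x₂, x₃)` (Jacobian `x₀²x₁`) to the GARLAND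
representation

  `G = [𝒢, 1/(t₀ t₁ (1 − t₂)(1 − t₃))]`,  `𝒢 = {1 > t₀ > t₁ > t₂ > 0, 0 < t₃ < t₀}`

(Yamamoto's integral of the 2-poset `•—•—∘` with a pendant `∘` below the top), and `𝒢` is
dissected (rule (1a), null walls `t₃ = t₁`, `t₃ = t₂`) according to the position of `t₃`:
`𝒢_a = {t₀ > t₃ > t₁ > t₂}`, `𝒢_b = {t₀ > t₁ > t₃ > t₂}`, `𝒢_c = {t₀ > t₁ > t₂ > t₃} = ∇⁴`.
Main results: `soloInformed_g_moveA : [R₁] − [G] ∈ relations`,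
`soloInformed_g_moveB : [G] − ([G_a] + [G_b] + [G_c]) ∈ relations`.
The identification of the pieces with `ζ(2,2)`, `ζ(3,1)`, `ζ(3,1)` (coordinate permutations) is
in `SoloInformedZetaFourSum`.

References: Kontsevich–Zagier 2001 §1.2 [KontsevichZagier2001]; S. Yamamoto, arXiv:1405.6499,
Thm 1.2; M. Kaneko, S. Yamamoto, arXiv:1605.03117.
-/

noncomputable section

open MeasureTheory Set MvPolynomial
open Literature.ModelTheory.ExponentialFields Literature.NumberTheory.Transcendental
open Literature.NumberTheory.Transcendental.KZ

namespace Summit.KontsevichZagierPeriods.KontsevichZagierPeriods.Theorems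

/-! ## 1. Coordinate half-spaces -/

/-- A garland cut out by THREE coordinate comparisons, `{t | t a < t b} ∩ {t | t c < t d} ∩ {t | t e < t f}`,
is `ℚ`-semialgebraic (each half-space is `{X_a < X_b}`, `isSemialgebraic_setOf_eval_lt`). -/
theorem soloInformed_isSemialgebraic_coordLt3 {m : ℕ} (a b c d e f : Fin m) :
    IsSemialgebraic ℚ ({t : Fin m → ℝ | t a < t b} ∩ {t : Fin m → ℝ | t c < t d} ∩
      {t : Fin m → ℝ | t e < t f}) := by
  have hS : ∀ i j : Fin m, {t : Fin m → ℝ | t i < t j} = {t | (aeval t (X i : MvPolynomial (Fin m) ℚ) : ℝ) <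
      aeval t (X j : MvPolynomial (Fin m) ℚ)} := fun i j => by
    ext t; simp
  rw [hS, hS, hS]
  exact ((isSemialgebraic_setOf_eval_lt (k := ℚ) (R := ℝ) _ _).inter
    (isSemialgebraic_setOf_eval_lt (k := ℚ) (R := ℝ) _ _)).inter (isSemialgebraic_setOf_eval_lt (k := ℚ) (R := ℝ) _ _)

/-- `{t | tᵢ < tⱼ}` is measurable. -/
theorem soloInformed_measurableSet_coordLt {m : ℕ} (i j : Fin m) :
    MeasurableSet {t : Fin m → ℝ | t i < t j} :=
  measurableSet_lt (measurable_pi_apply i) (measurable_pi_apply j)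

/-! ## 2. The garland domain and the integrand `1/(t₀t₁(1−t₂)(1−t₃))` -/

/-- The `ζ(3,1)`-integrand `z₃₁(t) = 1/(t₀ t₁ (1 − t₂)(1 − t₃))` (word `0011`). -/
def soloInformedZ31f (t : Fin 4 → ℝ) : ℝ := 1 / (t 0 * t 1 * (1 - t 2) * (1 - t 3))

/-- Its denominator is positive on the open cube. -/
theorem soloInformedZ31f_den_pos {t : Fin 4 → ℝ} (ht : t ∈ soloInformedOpenCube 4) :
    0 < t 0 * t 1 * (1 - t 2) * (1 - t 3) :=
  mul_pos (mul_pos (mul_pos (ht 0).1 (ht 1).1) (by linarith [(ht 2).2])) (by linarith [(ht 3).2])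

/-- The garland domain `𝒢 = (0,1)⁴ ∩ {t₁ < t₀} ∩ {t₂ < t₁} ∩ {t₃ < t₀}`. -/
def soloInformedGarland : Set (Fin 4 → ℝ) :=
  soloInformedOpenCube 4 ∩ ({t | t 1 < t 0} ∩ {t | t 2 < t 1} ∩ {t | t 3 < t 0})

/-- `𝒢` is `ℚ`-semialgebraic. -/
theorem isSemialgebraic_soloInformedGarland : IsSemialgebraic ℚ soloInformedGarland :=
  (isSemialgebraic_soloInformedOpenCube 4).inter
    (soloInformed_isSemialgebraic_coordLt3 1 0 2 1 3 0)

/-- `𝒢` is measurable. -/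
theorem soloInformed_measurableSet_garland : MeasurableSet soloInformedGarland :=
  (soloInformed_measurableSet_openCube 4).inter
    (((soloInformed_measurableSet_coordLt 1 0).inter (soloInformed_measurableSet_coordLt 2 1)).inter
      (soloInformed_measurableSet_coordLt 3 0))

/-! ## 3. The substitution `λ(x) = (x₀, x₀x₁, x₀x₁x₂, x₃)` -/

/-- The polynomial components of `λ`. -/
def soloInformedLamPoly : Fin 4 → MvPolynomial (Fin 4) ℚ := ![X 0, X 0 * X 1, X 0 * X 1 * X 2, X 3]

/-- `λ`. -/
def soloInformedLam : (Fin 4 → ℝ) → Fin 4 → ℝ := soloInformedPolyMap soloInformedLamPoly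

/-- `λ(x)₀ = x₀`. -/
@[simp] theorem soloInformedLam_zero (x : Fin 4 → ℝ) : soloInformedLam x 0 = x 0 := by
  simp [soloInformedLam, soloInformedLamPoly, soloInformedPolyMap]
/-- `λ(x)₁ = x₀x₁`. -/
@[simp] theorem soloInformedLam_one (x : Fin 4 → ℝ) : soloInformedLam x 1 = x 0 * x 1 := by
  simp [soloInformedLam, soloInformedLamPoly, soloInformedPolyMap]
/-- `λ(x)₂ = x₀x₁x₂`. -/
@[simp] theorem soloInformedLam_two (x : Fin 4 → ℝ) : soloInformedLam x 2 = x 0 * x 1 * x 2 := by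
  simp [soloInformedLam, soloInformedLamPoly, soloInformedPolyMap]
/-- `λ(x)₃ = x₃`. -/
@[simp] theorem soloInformedLam_three (x : Fin 4 → ℝ) : soloInformedLam x 3 = x 3 := by
  simp [soloInformedLam, soloInformedLamPoly, soloInformedPolyMap]

/-- **`det J_λ(x) = x₀²x₁`** (a triangular Jacobian). -/
theorem soloInformed_det_lam (x : Fin 4 → ℝ) :
    (soloInformedJacCLM soloInformedLamPoly x).det = x 0 * (x 0 * x 1) := by
  rw [soloInformed_det_jacCLM]
  simp [Matrix.det_succ_row_zero, Fin.sum_univ_succ, soloInformedLamPoly, pderiv_X,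
    Derivation.leibniz, Pi.single_apply, Fin.succAbove]

/-- `λ` is injective on the open cube. -/
theorem soloInformed_injOn_lam : InjOn soloInformedLam (soloInformedOpenCube 4) := by
  intro x hx x' hx' h
  have h0 : x 0 = x' 0 := by simpa using congr_fun h 0
  have h1' : x 0 * x 1 = x' 0 * x' 1 := by simpa using congr_fun h 1
  have h2' : x 0 * x 1 * x 2 = x' 0 * x' 1 * x' 2 := by simpa using congr_fun h 2
  have h3 : x 3 = x' 3 := by simpa using congr_fun h 3
  have h1 : x 1 = x' 1 := by
    rw [← h0] at h1'; exact mul_left_cancel₀ (hx 0).1.ne' h1'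
  have h2 : x 2 = x' 2 := by
    rw [← h0, ← h1] at h2'; exact mul_left_cancel₀ (mul_pos (hx 0).1 (hx 1).1).ne' h2'
  ext j; fin_cases j
  · exact h0
  · exact h1
  · exact h2
  · exact h3

/-- **`λ((0,1)⁴ ∩ {x₃ < x₀}) = 𝒢`.** -/
theorem soloInformed_image_lam :
    soloInformedLam '' (soloInformedOpenCube 4 ∩ {x | x 3 < x 0}) = soloInformedGarland := by
  refine Subset.antisymm ?_ fun t ht => ?_
  · rintro _ ⟨x, ⟨hx, h30⟩, rfl⟩
    have h0 := hx 0; have h1 := hx 1; have h2 := hx 2; have h3 := hx 3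
    have h30' : x 3 < x 0 := h30
    have h01 := mul_pos h0.1 h1.1
    refine ⟨fun j => ?_, ⟨?_, ?_⟩, ?_⟩
    · fin_cases j
      · simpa using h0
      · show 0 < soloInformedLam x 1 ∧ soloInformedLam x 1 < 1
        rw [soloInformedLam_one]; exact ⟨h01, by nlinarith⟩
      · show 0 < soloInformedLam x 2 ∧ soloInformedLam x 2 < 1
        rw [soloInformedLam_two]; exact ⟨mul_pos h01 h2.1, by nlinarith [mul_pos h01 h2.1]⟩
      · simpa using h3
    · show soloInformedLam x 1 < soloInformedLam x 0
      rw [soloInformedLam_one, soloInformedLam_zero]; nlinarith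
    · show soloInformedLam x 2 < soloInformedLam x 1
      rw [soloInformedLam_one, soloInformedLam_two]; nlinarith
    · show soloInformedLam x 3 < soloInformedLam x 0
      rw [soloInformedLam_three, soloInformedLam_zero]; exact h30'
  · have h0 := ht.1 0; have h1 := ht.1 1; have h2 := ht.1 2; have h3 := ht.1 3
    have h10 : t 1 < t 0 := ht.2.1.1
    have h21 : t 2 < t 1 := ht.2.1.2
    have h30 : t 3 < t 0 := ht.2.2
    refine ⟨![t 0, t 1 / t 0, t 2 / t 1, t 3], ⟨fun j => ?_, ?_⟩, ?_⟩
    · fin_cases j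
      · simpa using h0
      · simpa using And.intro (div_pos h1.1 h0.1) ((div_lt_one h0.1).2 h10)
      · simpa using And.intro (div_pos h2.1 h1.1) ((div_lt_one h1.1).2 h21)
      · simpa using h3
    · show Matrix.vecCons (t 0) ![t 1 / t 0, t 2 / t 1, t 3] 3 <
        Matrix.vecCons (t 0) ![t 1 / t 0, t 2 / t 1, t 3] 0
      simpa using h30
    · ext j; fin_cases j
      · simp
      · simp [mul_div_cancel₀ _ h0.1.ne']
      · simp [mul_div_cancel₀ _ h0.1.ne', mul_div_cancel₀ _ h1.1.ne']
      · simp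

/-! ## 4. The garland representation `G` and the move `R₁ ≡ G` -/

/-- The pull-back identity `R₁(x) = z₃₁(λ x) · |det J_λ(x)|` on the cube. -/
theorem soloInformedZ31f_lam {x : Fin 4 → ℝ} (hx : x ∈ soloInformedOpenCube 4) :
    1 / ((1 - x 1 * x 2 * x 0) * (1 - x 3)) =
      soloInformedZ31f (soloInformedLam x) * |(soloInformedJacCLM soloInformedLamPoly x).det| := by
  have h0 := hx 0; have h1 := hx 1; have h3 := hx 3
  rw [soloInformed_det_lam, abs_of_pos (mul_pos h0.1 (mul_pos h0.1 h1.1)), soloInformedZ31f]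
  simp only [soloInformedLam_zero, soloInformedLam_one, soloInformedLam_two, soloInformedLam_three]
  have ha : x 0 ≠ 0 := h0.1.ne'
  have hb : x 1 ≠ 0 := h1.1.ne'
  have hc : (1 - x 1 * x 2 * x 0) ≠ 0 := (soloInformed_Z4_one_sub_pos hx).ne'
  have hd : (1 - x 3) ≠ 0 := by linarith [h3.2]
  rw [show (1 - x 0 * x 1 * x 2) = (1 - x 1 * x 2 * x 0) by ring]
  field_simp

/-- Integrability of `z₃₁` on `𝒢` (transport of `R₁` along `λ`). -/
theorem soloInformed_integrableOn_z31f_garland : IntegrableOn soloInformedZ31f soloInformedGarland := by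
  rw [← soloInformed_image_lam, soloInformedLam, soloInformed_integrableOn_image_polyMap_iff _
    soloInformed_measurableSet_Z4D1 (soloInformed_injOn_lam.mono inter_subset_left)]
  have h := soloInformedZ4Datum.R1.integrableOn
  rw [soloInformedZ4_R1_domain] at h
  refine h.congr_fun (fun x hx => ?_) soloInformed_measurableSet_Z4D1
  rw [soloInformedZ4_R1_integrand, soloInformedZ31f_lam hx.1, mul_comm]
  rfl

/-- **The garland representation `G = [𝒢, 1/(t₀t₁(1−t₂)(1−t₃))]`.** -/
def soloInformedGRep : IntegralRep 4 where
  domain := soloInformedGarland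
  integrand := soloInformedZ31f
  isSemialgebraic_domain := isSemialgebraic_soloInformedGarland
  isSemialgebraicFunOn_integrand :=
    soloInformed_isSemialgebraicFunOn_quot isSemialgebraic_soloInformedGarland 1
      (X 0 * X 1 * (1 - X 2) * (1 - X 3)) _
      (fun t ht => by simpa using (soloInformedZ31f_den_pos ht.1).ne')
      fun t _ => by simp [soloInformedZ31f]
  integrableOn := soloInformed_integrableOn_z31f_garland

/-- **Move A (rule (2) along `λ`)**: `[R₁] − [G] ∈ relations`. -/
theorem soloInformed_g_moveA : of soloInformedZ4Datum.R1 - of soloInformedGRep ∈ relations := by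
  refine soloInformed_of_sub_of_mem_relations_polyMapCLM soloInformedLamPoly soloInformedZ4Datum.R1
    soloInformedGRep ?_ ?_ fun x hx => ?_
  · rw [soloInformedZ4_R1_domain]; exact soloInformed_injOn_lam.mono inter_subset_left
  · rw [soloInformedZ4_R1_domain]; exact soloInformed_image_lam.symm
  · rw [soloInformedZ4_R1_domain] at hx
    rw [soloInformedZ4_R1_integrand]
    exact soloInformedZ31f_lam hx.1

/-! ## 5. The dissection of `𝒢` by the position of `t₃` -/

/-- `𝒢_a = (0,1)⁴ ∩ {t₃ < t₀} ∩ {t₁ < t₃} ∩ {t₂ < t₁}` (`t₀ > t₃ > t₁ > t₂`). -/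
def soloInformedGa : Set (Fin 4 → ℝ) :=
  soloInformedOpenCube 4 ∩ ({t | t 3 < t 0} ∩ {t | t 1 < t 3} ∩ {t | t 2 < t 1})
/-- `𝒢_b = (0,1)⁴ ∩ {t₁ < t₀} ∩ {t₃ < t₁} ∩ {t₂ < t₃}` (`t₀ > t₁ > t₃ > t₂`). -/
def soloInformedGb : Set (Fin 4 → ℝ) :=
  soloInformedOpenCube 4 ∩ ({t | t 1 < t 0} ∩ {t | t 3 < t 1} ∩ {t | t 2 < t 3})
/-- `𝒢_c = ∇⁴ = (0,1)⁴ ∩ {t₁ < t₀} ∩ {t₂ < t₁} ∩ {t₃ < t₂}` (`t₀ > t₁ > t₂ > t₃`). -/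
def soloInformedNabla4 : Set (Fin 4 → ℝ) :=
  soloInformedOpenCube 4 ∩ ({t | t 1 < t 0} ∩ {t | t 2 < t 1} ∩ {t | t 3 < t 2})

/-- `𝒢_a` is `ℚ`-semialgebraic. -/
theorem isSemialgebraic_soloInformedGa : IsSemialgebraic ℚ soloInformedGa :=
  (isSemialgebraic_soloInformedOpenCube 4).inter
    (soloInformed_isSemialgebraic_coordLt3 3 0 1 3 2 1)
/-- `𝒢_b` is `ℚ`-semialgebraic. -/
theorem isSemialgebraic_soloInformedGb : IsSemialgebraic ℚ soloInformedGb :=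
  (isSemialgebraic_soloInformedOpenCube 4).inter
    (soloInformed_isSemialgebraic_coordLt3 1 0 3 1 2 3)
/-- `∇⁴` is `ℚ`-semialgebraic. -/
theorem isSemialgebraic_soloInformedNabla4 : IsSemialgebraic ℚ soloInformedNabla4 :=
  (isSemialgebraic_soloInformedOpenCube 4).inter
    (soloInformed_isSemialgebraic_coordLt3 1 0 2 1 3 2)
/-- `∇⁴` is measurable. -/
theorem soloInformed_measurableSet_nabla4 : MeasurableSet soloInformedNabla4 :=
  (soloInformed_measurableSet_openCube 4).inter
    (((soloInformed_measurableSet_coordLt 1 0).inter (soloInformed_measurableSet_coordLt 2 1)).inter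
      (soloInformed_measurableSet_coordLt 3 2))

/-- Membership in `𝒢`. -/
theorem soloInformed_mem_garland {t : Fin 4 → ℝ} : t ∈ soloInformedGarland ↔
    t ∈ soloInformedOpenCube 4 ∧ t 1 < t 0 ∧ t 2 < t 1 ∧ t 3 < t 0 := by
  simp only [soloInformedGarland, mem_inter_iff, mem_setOf_eq, and_assoc]
/-- Membership in `𝒢_a`. -/
theorem soloInformed_mem_Ga {t : Fin 4 → ℝ} : t ∈ soloInformedGa ↔
    t ∈ soloInformedOpenCube 4 ∧ t 3 < t 0 ∧ t 1 < t 3 ∧ t 2 < t 1 := by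
  simp only [soloInformedGa, mem_inter_iff, mem_setOf_eq, and_assoc]
/-- Membership in `𝒢_b`. -/
theorem soloInformed_mem_Gb {t : Fin 4 → ℝ} : t ∈ soloInformedGb ↔
    t ∈ soloInformedOpenCube 4 ∧ t 1 < t 0 ∧ t 3 < t 1 ∧ t 2 < t 3 := by
  simp only [soloInformedGb, mem_inter_iff, mem_setOf_eq, and_assoc]
/-- Membership in `∇⁴`. -/
theorem soloInformed_mem_nabla4 {t : Fin 4 → ℝ} : t ∈ soloInformedNabla4 ↔
    t ∈ soloInformedOpenCube 4 ∧ t 1 < t 0 ∧ t 2 < t 1 ∧ t 3 < t 2 := by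
  simp only [soloInformedNabla4, mem_inter_iff, mem_setOf_eq, and_assoc]

/-- `𝒢_a ⊆ 𝒢`. -/
theorem soloInformedGa_subset : soloInformedGa ⊆ soloInformedGarland := fun t ht => by
  rw [soloInformed_mem_Ga] at ht
  exact soloInformed_mem_garland.2 ⟨ht.1, lt_trans ht.2.2.1 ht.2.1, ht.2.2.2, ht.2.1⟩
/-- `𝒢_b ⊆ 𝒢`. -/
theorem soloInformedGb_subset : soloInformedGb ⊆ soloInformedGarland := fun t ht => by
  rw [soloInformed_mem_Gb] at ht
  exact soloInformed_mem_garland.2 ⟨ht.1, ht.2.1, lt_trans ht.2.2.2 ht.2.2.1, lt_trans ht.2.2.1 ht.2.1⟩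
/-- `∇⁴ ⊆ 𝒢`. -/
theorem soloInformedNabla4_subset : soloInformedNabla4 ⊆ soloInformedGarland := fun t ht => by
  rw [soloInformed_mem_nabla4] at ht
  exact soloInformed_mem_garland.2
    ⟨ht.1, ht.2.1, ht.2.2.1, lt_trans (lt_trans ht.2.2.2 ht.2.2.1) ht.2.1⟩

/-- `G_a = G|_{𝒢_a}`. -/
def soloInformedGaRep : IntegralRep 4 :=
  soloInformedGRep.restrict soloInformedGa isSemialgebraic_soloInformedGa soloInformedGa_subset
/-- `G_b = G|_{𝒢_b}`. -/
def soloInformedGbRep : IntegralRep 4 :=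
  soloInformedGRep.restrict soloInformedGb isSemialgebraic_soloInformedGb soloInformedGb_subset
/-- `G_c = G|_{∇⁴} = [∇⁴, 1/(t₀t₁(1−t₂)(1−t₃))]`, the simplex representation of `ζ(3,1)`. -/
def soloInformedGcRep : IntegralRep 4 :=
  soloInformedGRep.restrict soloInformedNabla4 isSemialgebraic_soloInformedNabla4
    soloInformedNabla4_subset

/-- The three pieces. -/
def soloInformedGPieces : Fin 3 → IntegralRep 4 :=
  ![soloInformedGaRep, soloInformedGbRep, soloInformedGcRep]

/-- The wall polynomial `(X₃ − X₁)(X₃ − X₂) ≠ 0`. -/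
theorem soloInformed_gWall_ne :
    ((X 3 - X 1) * (X 3 - X 2) : MvPolynomial (Fin 4) ℚ) ≠ 0 := by
  refine mul_ne_zero (fun h => ?_) (fun h => ?_)
  · have := congr_arg (fun p : MvPolynomial (Fin 4) ℚ => aeval (fun j : Fin 4 => if j = 3 then (1:ℚ) else 0) p) h
    simp at this
  · have := congr_arg (fun p : MvPolynomial (Fin 4) ℚ => aeval (fun j : Fin 4 => if j = 3 then (1:ℚ) else 0) p) h
    simp at this

/-- The walls `𝒢 \ (𝒢_a ∪ 𝒢_b ∪ ∇⁴) ⊆ {t₃ = t₁} ∪ {t₃ = t₂}` are null. -/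
theorem soloInformed_gWall_null :
    volume (soloInformedGarland \ ⋃ j ∈ (Finset.univ : Finset (Fin 3)),
      (soloInformedGPieces j).domain) = 0 := by
  refine soloInformed_volume_eq_zero_of_subset_zeroSet _ soloInformed_gWall_ne fun t ht => ?_
  have hG := soloInformed_mem_garland.1 ht.1
  have hnot := ht.2
  simp only [Finset.mem_univ, iUnion_true, mem_iUnion, not_exists] at hnot
  rcases lt_trichotomy (t 1) (t 3) with h13 | h13 | h31
  · exact absurd (show t ∈ soloInformedGa from
      soloInformed_mem_Ga.2 ⟨hG.1, hG.2.2.2, h13, hG.2.2.1⟩) (hnot 0)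
  · simp [h13]
  · rcases lt_trichotomy (t 2) (t 3) with h23 | h23 | h32
    · exact absurd (show t ∈ soloInformedGb from
        soloInformed_mem_Gb.2 ⟨hG.1, hG.2.1, h31, h23⟩) (hnot 1)
    · simp [h23]
    · exact absurd (show t ∈ soloInformedNabla4 from
        soloInformed_mem_nabla4.2 ⟨hG.1, hG.2.1, hG.2.2.1, h32⟩) (hnot 2)

/-- **Move B (rule (1a))**: `[G] − ([G_a] + [G_b] + [G_c]) ∈ relations`. -/
theorem soloInformed_g_moveB :
    of soloInformedGRep - (of soloInformedGaRep + of soloInformedGbRep + of soloInformedGcRep)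
      ∈ relations := by
  have h := of_sub_sum_of_mem_relations_of_subset (Finset.univ : Finset (Fin 3)) soloInformedGRep
    soloInformedGPieces
    (fun j _ => by fin_cases j <;> [exact soloInformedGa_subset; exact soloInformedGb_subset;
      exact soloInformedNabla4_subset])
    (fun j _ => by fin_cases j <;> exact fun _ _ => rfl) soloInformed_gWall_null
    (fun j _ j' _ hjj' => by
      fin_cases j <;> fin_cases j'
      · exact (hjj' rfl).elim
      · exact disjoint_left.2 fun t (ht : t ∈ soloInformedGa) (ht' : t ∈ soloInformedGb) =>
          lt_asymm (soloInformed_mem_Ga.1 ht).2.2.1 (soloInformed_mem_Gb.1 ht').2.2.1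
      · exact disjoint_left.2 fun t (ht : t ∈ soloInformedGa) (ht' : t ∈ soloInformedNabla4) =>
          lt_asymm (soloInformed_mem_Ga.1 ht).2.2.1
            (lt_trans (soloInformed_mem_nabla4.1 ht').2.2.2 (soloInformed_mem_nabla4.1 ht').2.2.1)
      · exact disjoint_left.2 fun t (ht : t ∈ soloInformedGb) (ht' : t ∈ soloInformedGa) =>
          lt_asymm (soloInformed_mem_Gb.1 ht).2.2.1 (soloInformed_mem_Ga.1 ht').2.2.1
      · exact (hjj' rfl).elim
      · exact disjoint_left.2 fun t (ht : t ∈ soloInformedGb) (ht' : t ∈ soloInformedNabla4) =>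
          lt_asymm (soloInformed_mem_Gb.1 ht).2.2.2 (soloInformed_mem_nabla4.1 ht').2.2.2
      · exact disjoint_left.2 fun t (ht : t ∈ soloInformedNabla4) (ht' : t ∈ soloInformedGa) =>
          lt_asymm (lt_trans (soloInformed_mem_nabla4.1 ht).2.2.2 (soloInformed_mem_nabla4.1 ht).2.2.1)
            (soloInformed_mem_Ga.1 ht').2.2.1
      · exact disjoint_left.2 fun t (ht : t ∈ soloInformedNabla4) (ht' : t ∈ soloInformedGb) =>
          lt_asymm (soloInformed_mem_nabla4.1 ht).2.2.2 (soloInformed_mem_Gb.1 ht').2.2.2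
      · exact (hjj' rfl).elim)
  simpa [soloInformedGPieces, Fin.sum_univ_three, add_assoc] using h

/-- Unfolding lemmas. -/
@[simp] theorem soloInformedGaRep_domain : soloInformedGaRep.domain = soloInformedGa := rfl
/-- Auxiliary. -/
@[simp] theorem soloInformedGaRep_integrand : soloInformedGaRep.integrand = soloInformedZ31f := rfl
/-- Auxiliary. -/
@[simp] theorem soloInformedGbRep_domain : soloInformedGbRep.domain = soloInformedGb := rfl
/-- Auxiliary. -/
@[simp] theorem soloInformedGbRep_integrand : soloInformedGbRep.integrand = soloInformedZ31f := rfl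
/-- Auxiliary. -/
@[simp] theorem soloInformedGcRep_domain : soloInformedGcRep.domain = soloInformedNabla4 := rfl
/-- Auxiliary. -/
@[simp] theorem soloInformedGcRep_integrand : soloInformedGcRep.integrand = soloInformedZ31f := rfl

end Summit.KontsevichZagierPeriods.KontsevichZagierPeriods.Theorems
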